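import Literature.Probability.LatticeModels.IsingExponents
import HarnessLib

/-!
# The anomalous dimension of the critical 3D Ising model is at most `1/2` (if it exists):
# Duminil-Copin–Panis, CMP 406 (2025), arXiv:2404.05700, Theorem 1.5

Topic `Literature/Probability/LatticeModels`; family `crit-ising`. NAMED FACT only (a `def` of
type `Prop`, no axiom, nothing proved here), vendored AS PRINTED.

Setting of the source (§1, arXiv:2404.05700 pp. 3–6): the nearest-neighbour Ising model on
`ℤ^d`, `⟨·⟩_β` the weak limit of the finite-volume free-boundary measures, `|·|` the sup norm,
and the critical exponent `η` DEFINED by eq. (1.3),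
`⟨τ₀τ_x⟩_{β_c} = |x|^{-(d-2+η-o(1))}` "where `o(1)` is a quantity tending to zero as `|x|` tends
to infinity" — i.e. `log ⟨σ₀σ_x⟩_{β_c} / log |x| → -(d-2+η)` as `x → ∞`, which is exactly the
tree's logarithmic exponent `HasIsingExponentEta d η`
(`= HasSpatialDecayExponent (criticalTwoPoint d) (d - 2 + η)`, filter `cofinite` on `ℤ^d`,
norm-independent). The tree's `criticalTwoPoint d` is the plus state `⟨σ₀σ_x⟩⁺_{β_c,0}`; for
`d ≥ 3` it coincides with the free state of the source
(`twoPointPlus_criticalBeta_eq_twoPointFree_holds`, Aizenman–Duminil-Copin–Sidoravicius 2015),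
so the rendering below with `criticalTwoPoint 3` is the printed statement.

Printed proof (p. 6): plug the ansatz (1.3) into Theorem 1.3 (the axial lower bound
`⟨τ₀τ_{ne₁}⟩_{β_c} ≥ c₁ / (χ_{4n}(β_c) + n^{d-2} ∑_{k ≤ 2n} k⟨τ₀τ_{ke₁}⟩_{β_c})`, vendored in
`CriticalTwoPointDCPLower.lean` as `dcp_criticalTwoPoint_axis_lower`): with `d = 3` both terms of
the denominator are `n^{2-η+o(1)}`, whence `n^{-(1+η)+o(1)} ≥ c n^{-(2-η)-o(1)}`, i.e. `η ≤ 1/2`.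

Why this fact is here: it is the nearest PRINTED result to the open support statement
`Summit.CriticalPhenomena.Ising3DConformalLimit.Theses.LatticeSDPCertificates.WindowBelowHalf`
(item stmt-CriticalPhenomena-5507: WINDOW, `c (n/m)^{-(3/2-ε)} ⟨σ₀σ_{me₁}⟩_{β_c} ≤ ⟨σ₀σ_{ne₁}⟩_{β_c}`
for all `1 ≤ m ≤ n`, an "effective `η < 1/2` between every pair of scales"), which is STRICTLY
STRONGER than the print: Theorem 1.5 assumes that `η` exists (a pure power law up to `|x|^{o(1)}`)
and concludes the non-strict `η ≤ 1/2`; it compares no two finite scales and allows `η = 1/2`.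

Deliberately NOT here: Theorems 1.2–1.3 (in `CriticalTwoPointDCPLower.lean`), Theorem 1.4
(`d ≥ 4` pointwise lower bounds), Theorems 1.6–1.8 (correlation lengths, `ν`, bubble divergence),
and the `φ⁴` versions.

## References

* H. Duminil-Copin, R. Panis, *New lower bounds for the (near) critical Ising and φ⁴ models'
  two-point functions*, Comm. Math. Phys. 406 (2025), arXiv:2404.05700, Theorem 1.5 (p. 6 of the
  arXiv version, held: "Theorem 1.5. Let `d = 3`. If the critical exponent `η` exists, it
  satisfies `η ≤ 1/2`.") [DuminilCopinPanis2025LowerBounds].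
-/

noncomputable section

namespace Literature.Probability.LatticeModels

/-- **Duminil-Copin–Panis 2025, Theorem 1.5 (`η ≤ 1/2` on `ℤ³`).** Printed: "Theorem 1.5. Let
`d = 3`. If the critical exponent `η` exists, it satisfies `η ≤ 1/2`." Here "`η` exists" is the
source's eq. (1.3), `⟨σ₀σ_x⟩_{β_c} = |x|^{-(d-2+η-o(1))}` with `o(1) → 0` as `|x| → ∞`, i.e. the
tree's logarithmic exponent `HasIsingExponentEta 3 η` of the critical two-point function
`criticalTwoPoint 3` (plus state = free state at `β_c` for `d ≥ 3`). Nearest print to, and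
strictly weaker than, the route statement
`Summit.CriticalPhenomena.Ising3DConformalLimit.Theses.LatticeSDPCertificates.WindowBelowHalf`
(grounds item stmt-CriticalPhenomena-5507 as "item STRONGER than print"). Named fact (D-0014).
[cite: DuminilCopinPanis2025LowerBounds, Theorem 1.5 (arXiv:2404.05700 p. 6)] -/
def dcp_isingEta_le_half : Prop :=
  ∀ η : ℝ, HasIsingExponentEta 3 η → η ≤ 1 / 2

end Literature.Probability.LatticeModels
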